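import Summits.NavierStokesRegularity.NavierStokesRegularity.Theorems.LerayQuarterDissipationRecurrentReductionDRecurrent
import HarnessLib

/-!
# Route `LerayQuarterDissipation`, item `RecurrentReductionD` (stmt-NavierStokesRegularity-22507):
# Birkhoff recurrence on the scaling hull — persistence hypothesis in the uniform form

Helper file (theorems only, `--supports` the item). The reduction
`exists_recurrent_of_persistent` (`LerayQuarterDissipationRecurrentReductionDRecurrent.lean`)
asks that the apex singularity persist along every POINTWISE limit of rescalings of the given
profile. The orbit limits produced by `orbitLimit` converge UNIFORMLY on the slab pieces
`[−(n+2), −1/(n+2)] × B̄(0, n+2)`, and the ε-regularity route to persistence needs exactly this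
uniform convergence (smallness of the limit on a piece transfers to the approximants). This file
re-runs the same Birkhoff–Furstenberg argument with the persistence hypothesis stated for limits
which are uniform on the pieces AND pointwise on the open slab
(`exists_recurrent_of_persistent_unif`); nothing else changes.

References: H. Furstenberg (1981), Ch. 1 §4, Thm. 1.16 [Furstenberg1981]; G. Koch,
N. Nadirashvili, G. Seregin, V. Šverák, arXiv:0709.3599, Prop. 4.1, Lemma 6.1
[KochNadirashviliSereginSverak2009].
-/

noncomputable section

-- the summit and its single problem share the name (D-0017 nested layout)
set_option linter.dupNamespace false

namespace Summit.NavierStokesRegularity.NavierStokesRegularity.Theorems.RecurrentReductionD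

open scoped Topology
open MeasureTheory Set Function Filter Metric TopologicalSpace Topology
open Literature.Analysis.FluidPDE
open Literature.Dynamics.TopologicalDynamics
open Summit.NavierStokesRegularity.NavierStokesRegularity.Theorems.AdaptedFrequencyConverges.BirkhoffRecurrentHull
open scoped ENNReal NNReal

/-! ### Birkhoff recurrence on the orbit closure (uniform persistence hypothesis) -/

/-- **Reduction to a uniformly recurrent element of `𝒟_{C,K}`, modulo persistence of the apex
singularity along orbit limits which are uniform on the slab pieces** (twin of
`exists_recurrent_of_persistent`, whose persistence hypothesis is asked of all pointwise limits). Let `u ∈ 𝒟_{C,K}` be such that every field of the Type-I class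
which is a pointwise limit on the open slab of rescalings `u_{l_k}`, `l_k > 0`, exceeds every
bound on every backward cylinder `(−r², 0) × B(0, r)`. Then some `w ∈ 𝒟_{C,K}` exceeds every
bound on every backward cylinder at the origin and is uniformly recurrent under the scaling flow
`σ ↦ e^σ w(e^{2σ}·, e^σ·)`, uniformly on the compact sets `[−R², −R⁻²] × B̄(0, R)`.
Proof: MODEL — the fields of `𝒟_{C,K}` with the initial topology of their restrictions to the
slab pieces (pseudo-metrisable; convergence = uniform convergence on every piece), on which the
scaling flow `ϕ σ w = w_{e^σ}` acts continuously (`exists_slabPiece_mapsTo_dilate`); ORBIT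
CLOSURE — compact by `orbitLimit` and invariant (`mapsTo_closure_orbit`); BIRKHOFF —
`exists_isUniformlyRecurrentPt`; the recurrent point is a limit of orbit points, hence singular by
the persistence hypothesis; UNWINDING — `isSyndetic_iff_exists_window` on the sup-ball of a piece
containing `[−R², −R⁻²] × B̄(0, R)`. [cite: Furstenberg1981, Ch. 1 §4, Thm. 1.16] -/
theorem exists_recurrent_of_persistent_unif {C K : ℝ}
    {u : ℝ → EuclideanSpace ℝ (Fin 3) → EuclideanSpace ℝ (Fin 3)}
    (hu : IsTypeIAncientMild C u)
    (hlaw : ∀ s : ℝ, s < 0 → ∫⁻ x, ‖fderiv ℝ (u s) x‖ₑ ^ 2 ≤ ENNReal.ofReal (K / Real.sqrt (-s)))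
    (hpers : ∀ l : ℕ → ℝ, (∀ k, 0 < l k) →
      ∀ W : ℝ → EuclideanSpace ℝ (Fin 3) → EuclideanSpace ℝ (Fin 3), IsTypeIAncientMild C W →
        (∀ n : ℕ, TendstoUniformlyOn (fun k z => nsRescale (l k) u z.1 z.2) (fun z => W z.1 z.2)
          atTop (Icc (-((n : ℝ) + 2)) (-(1 / ((n : ℝ) + 2))) ×ˢ
            closedBall (0 : EuclideanSpace ℝ (Fin 3)) ((n : ℝ) + 2))) →
        (∀ t < 0, ∀ x, Tendsto (fun k => nsRescale (l k) u t x) atTop (𝓝 (W t x))) →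
        ∀ r > 0, ∀ M : ℝ, ∃ t ∈ Ioo (-(r ^ 2)) (0 : ℝ),
          ∃ x ∈ ball (0 : EuclideanSpace ℝ (Fin 3)) r, M < ‖W t x‖) :
    ∃ w : ℝ → EuclideanSpace ℝ (Fin 3) → EuclideanSpace ℝ (Fin 3),
      IsTypeIAncientMild C w ∧
      (∀ s : ℝ, s < 0 → ∫⁻ x, ‖fderiv ℝ (w s) x‖ₑ ^ 2 ≤ ENNReal.ofReal (K / Real.sqrt (-s))) ∧
      (∀ ε > 0, ∀ R > 1, ∃ L > 0, ∀ a : ℝ, ∃ σ ∈ Icc a (a + L),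
        ∀ s ∈ Icc (-(R ^ 2)) (-(R⁻¹) ^ 2), ∀ y ∈ closedBall (0 : EuclideanSpace ℝ (Fin 3)) R,
          ‖Real.exp σ • w (Real.exp (2 * σ) * s) (Real.exp σ • y) - w s y‖ ≤ ε) ∧
      (∀ r > 0, ∀ M : ℝ, ∃ t ∈ Ioo (-(r ^ 2)) (0 : ℝ),
        ∃ x ∈ ball (0 : EuclideanSpace ℝ (Fin 3)) r, M < ‖w t x‖) := by
  classical
  -- dilated slab pieces lie in larger slab pieces (cf. the tree's `exists_slabPiece_mapsTo_dilate`)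
  have hdil : ∀ {l : ℝ}, 0 < l → ∀ n : ℕ, ∃ m : ℕ, ∀ z ∈ Icc (-((n : ℝ) + 2)) (-(1 / ((n : ℝ) + 2))) ×ˢ
        closedBall (0 : EuclideanSpace ℝ (Fin 3)) ((n : ℝ) + 2),
      ((l ^ 2 * z.1, l • z.2) : ℝ × EuclideanSpace ℝ (Fin 3)) ∈
        Icc (-((m : ℝ) + 2)) (-(1 / ((m : ℝ) + 2))) ×ˢ
          closedBall (0 : EuclideanSpace ℝ (Fin 3)) ((m : ℝ) + 2) := by
    intro l hl n
    set N : ℝ := (n : ℝ) + 2 with hN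
    have hN0 : 0 < N := by positivity
    have hl2 : 0 < l ^ 2 := by positivity
    have hli : 0 < (l ^ 2)⁻¹ := inv_pos.2 hl2
    obtain ⟨m, hm⟩ := exists_nat_ge ((l ^ 2 + (l ^ 2)⁻¹ + l) * N)
    have hM0 : (0 : ℝ) < (m : ℝ) + 2 := by positivity
    have hM : (l ^ 2 + (l ^ 2)⁻¹ + l) * N ≤ (m : ℝ) + 2 := hm.trans (by linarith)
    have hA : l ^ 2 * N ≤ (m : ℝ) + 2 := le_trans (by nlinarith) hM
    have hB : (l ^ 2)⁻¹ * N ≤ (m : ℝ) + 2 := le_trans (by nlinarith) hM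
    have hC : l * N ≤ (m : ℝ) + 2 := le_trans (by nlinarith) hM
    refine ⟨m, fun z hz => ?_⟩
    obtain ⟨⟨h1, h2⟩, h3⟩ := mem_slabPiece.1 hz
    refine mem_slabPiece.2 ⟨⟨by nlinarith, ?_⟩, ?_⟩
    · have key : 1 / ((m : ℝ) + 2) ≤ l ^ 2 * (1 / N) := by
        rw [div_le_iff₀ hM0]
        calc (1 : ℝ) = l ^ 2 * (1 / N) * ((l ^ 2)⁻¹ * N) := by field_simp
          _ ≤ l ^ 2 * (1 / N) * ((m : ℝ) + 2) := mul_le_mul_of_nonneg_left hB (by positivity)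
      have : l ^ 2 * z.1 ≤ l ^ 2 * (-(1 / N)) := mul_le_mul_of_nonneg_left h2 hl2.le
      show l ^ 2 * z.1 ≤ -(1 / ((m : ℝ) + 2))
      linarith
    · show ‖l • z.2‖ ≤ (m : ℝ) + 2
      rw [norm_smul, Real.norm_of_nonneg hl.le]
      nlinarith
  -- ## the hull: the class `𝒟_{C,K}`
  set P : (ℝ → EuclideanSpace ℝ (Fin 3) → EuclideanSpace ℝ (Fin 3)) → Prop := fun p =>
    IsTypeIAncientMild C p ∧
      ∀ s : ℝ, s < 0 → ∫⁻ x, ‖fderiv ℝ (p s) x‖ₑ ^ 2 ≤ ENNReal.ofReal (K / Real.sqrt (-s))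
    with hP
  have hPz : ∀ p, P p → ∀ c : ℝ, 0 < c → P (nsRescale c p) := by
    rintro p ⟨h1, h2⟩ c hc
    exact ⟨isTypeIAncientMild_nsRescale h1 hc, dissipationLaw_nsRescale h2 hc⟩
  let X := {p : ℝ → EuclideanSpace ℝ (Fin 3) → EuclideanSpace ℝ (Fin 3) // P p}
  -- the slab pieces
  set T : ℕ → Set (ℝ × EuclideanSpace ℝ (Fin 3)) := fun n =>
    Icc (-((n : ℝ) + 2)) (-(1 / ((n : ℝ) + 2))) ×ˢ
      closedBall (0 : EuclideanSpace ℝ (Fin 3)) ((n : ℝ) + 2) with hT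
  haveI hTc : ∀ n, CompactSpace (T n) := fun n =>
    isCompact_iff_compactSpace.1 (isCompact_slabPiece n)
  have hTsub : ∀ n, T n ⊆ Iio (0:ℝ) ×ˢ (univ : Set (EuclideanSpace ℝ (Fin 3))) := fun n z hz =>
    ⟨neg_of_mem_slabPiece hz, mem_univ _⟩
  -- ## the model map and the topology
  have hcW : ∀ (p : X) (n : ℕ), Continuous fun z : T n => p.1 z.1.1 z.1.2 := fun p n =>
    continuousOn_iff_continuous_restrict.1 (p.2.1.continuousOn_uncurry.mono (hTsub n))
  let Φ : X → ((n : ℕ) → C(T n, EuclideanSpace ℝ (Fin 3))) := fun p n =>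
    ⟨fun z => p.1 z.1.1 z.1.2, hcW p n⟩
  letI tX : TopologicalSpace X := TopologicalSpace.induced Φ inferInstance
  have hΦ : IsInducing Φ := ⟨rfl⟩
  haveI hXm : PseudoMetrizableSpace X := hΦ.pseudoMetrizableSpace
  -- convergence in `X` is uniform convergence on every piece
  have htend : ∀ (x : ℕ → X) (a : X), Tendsto x atTop (𝓝 a) ↔
      ∀ n, TendstoUniformlyOn (fun j z => (x j).1 z.1 z.2) (fun z => a.1 z.1 z.2) atTop (T n) := by
    intro x a
    rw [hΦ.tendsto_nhds_iff, tendsto_pi_nhds]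
    constructor
    · intro h n
      have h1 := h n
      rw [ContinuousMap.tendsto_iff_tendstoUniformly] at h1
      rw [tendstoUniformlyOn_iff_tendstoUniformly_comp_coe]
      exact h1
    · intro h n
      rw [ContinuousMap.tendsto_iff_tendstoUniformly]
      have h1 := h n
      rw [tendstoUniformlyOn_iff_tendstoUniformly_comp_coe] at h1
      exact h1
  -- ## the scaling flow on `X`
  let ϕ : ℝ → X → X := fun σ p =>
    ⟨nsRescale (Real.exp σ) p.1, hPz p.1 p.2 (Real.exp σ) (Real.exp_pos σ)⟩
  have hadd : ∀ s t (p : X), ϕ (s + t) p = ϕ s (ϕ t p) := by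
    intro s t p
    apply Subtype.ext
    show nsRescale (Real.exp (s + t)) p.1 = nsRescale (Real.exp s) (nsRescale (Real.exp t) p.1)
    rw [Real.exp_add, mul_comm, nsRescale_mul]
  have hcont : ∀ σ, Continuous (ϕ σ) := by
    intro σ
    refine continuous_iff_seqContinuous.2 fun x a hxa => ?_
    rw [htend] at hxa ⊢
    have hl0 : 0 < Real.exp σ := Real.exp_pos σ
    intro n
    obtain ⟨m, hm⟩ := hdil hl0 n
    rw [Metric.tendstoUniformlyOn_iff]
    intro ε hε
    filter_upwards [Metric.tendstoUniformlyOn_iff.1 (hxa m) (ε / Real.exp σ) (div_pos hε hl0)]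
      with j hj z hz
    have h := hj (Real.exp σ ^ 2 * z.1, Real.exp σ • z.2) (hm z hz)
    show dist (nsRescale (Real.exp σ) a.1 z.1 z.2) (nsRescale (Real.exp σ) (x j).1 z.1 z.2) < ε
    rw [nsRescale_apply, nsRescale_apply, dist_smul₀, Real.norm_of_nonneg hl0.le]
    calc Real.exp σ * dist (a.1 (Real.exp σ ^ 2 * z.1) (Real.exp σ • z.2))
          ((x j).1 (Real.exp σ ^ 2 * z.1) (Real.exp σ • z.2))
        < Real.exp σ * (ε / Real.exp σ) := mul_lt_mul_of_pos_left h hl0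
      _ = ε := mul_div_cancel₀ _ hl0.ne'
  -- ## the base point and its orbit closure
  let x₀ : X := ⟨u, hu, hlaw⟩
  set S : Set X := closure (range fun σ => ϕ σ x₀) with hS
  have hSinv : ∀ t, MapsTo (ϕ t) S S := fun t => mapsTo_closure_orbit hcont hadd t x₀
  have hSne : S.Nonempty := ⟨ϕ 0 x₀, subset_closure ⟨0, rfl⟩⟩
  -- ## KEY: subsequential limits of orbit sequences, with pointwise convergence
  have hkey : ∀ σs : ℕ → ℝ, ∃ (b : X) (ψ : ℕ → ℕ), StrictMono ψ ∧
      Tendsto (fun j => ϕ (σs (ψ j)) x₀) atTop (𝓝 b) ∧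
      ∀ t < 0, ∀ x, Tendsto (fun j => nsRescale (Real.exp (σs (ψ j))) u t x) atTop
        (𝓝 (b.1 t x)) := by
    intro σs
    obtain ⟨ψ, hψ, W, hW, hlawW, hWu, hpt⟩ :=
      orbitLimit hu hlaw (fun k => Real.exp (σs k)) (fun k => Real.exp_pos _)
    refine ⟨⟨W, hW, hlawW⟩, ψ, hψ, ?_, hpt⟩
    rw [htend]
    exact hWu
  -- ## compactness of the orbit closure (sequential compactness in a pseudo-metrisable space)
  have hScpt : IsCompact S := by
    letI mX : PseudoMetricSpace X := TopologicalSpace.pseudoMetrizableSpacePseudoMetric X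
    refine IsSeqCompact.isCompact fun x hx => ?_
    have hnear : ∀ k : ℕ, ∃ σ : ℝ, dist (x k) (ϕ σ x₀) < 1 / ((k : ℝ) + 1) := by
      intro k
      have hk : (0 : ℝ) < 1 / ((k : ℝ) + 1) := by positivity
      obtain ⟨b, hb, hd⟩ := Metric.mem_closure_iff.1 (hx k) (1 / ((k : ℝ) + 1)) hk
      obtain ⟨σ, rfl⟩ := hb
      exact ⟨σ, hd⟩
    choose σs hσs using hnear
    obtain ⟨a, ψ, hψ, ha, -⟩ := hkey σs
    refine ⟨a, ?_, ψ, hψ, ?_⟩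
    · exact isClosed_closure.mem_of_tendsto ha (Eventually.of_forall fun j => subset_closure ⟨_, rfl⟩)
    · refine ha.congr_dist ?_
      have h1 : Tendsto (fun j => 1 / (((ψ j : ℕ) : ℝ) + 1)) atTop (𝓝 0) :=
        (tendsto_one_div_add_atTop_nhds_zero_nat (𝕜 := ℝ)).comp hψ.tendsto_atTop
      refine squeeze_zero (fun j => dist_nonneg) (fun j => ?_) h1
      rw [dist_comm]
      exact (hσs (ψ j)).le
  -- ## Birkhoff: a uniformly recurrent point of the orbit closure
  obtain ⟨a, haS, hrec⟩ := exists_isUniformlyRecurrentPt hcont hadd hScpt hSne hSinv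
  obtain ⟨haW, halaw⟩ := a.2
  -- ## the recurrent point is singular: it is a limit of orbit points
  have hasing : ∀ r > 0, ∀ M : ℝ, ∃ t ∈ Ioo (-(r ^ 2)) (0 : ℝ),
      ∃ x ∈ ball (0 : EuclideanSpace ℝ (Fin 3)) r, M < ‖a.1 t x‖ := by
    letI mX : PseudoMetricSpace X := TopologicalSpace.pseudoMetrizableSpacePseudoMetric X
    obtain ⟨xs, hxs, hxa⟩ := mem_closure_iff_seq_limit.1 haS
    choose σs hσs using hxs
    obtain ⟨b, ψ, hψ, hb, hbpt⟩ := hkey σs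
    have hxa' : Tendsto (fun j => ϕ (σs (ψ j)) x₀) atTop (𝓝 a) :=
      (hxa.comp hψ.tendsto_atTop).congr fun j => (hσs (ψ j)).symm
    -- `a` and `b` agree on the open slab (both are limits of the same orbit sequence)
    have hab : ∀ t < 0, ∀ x, a.1 t x = b.1 t x := by
      intro t ht x
      have h1 : Tendsto (fun j => nsRescale (Real.exp (σs (ψ j))) u t x) atTop (𝓝 (a.1 t x)) := by
        have h := (htend _ a).1 hxa'
        exact tendsto_of_tendstoUniformlyOn_slabPiece h ht x
      exact tendsto_nhds_unique h1 (hbpt t ht x)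
    have hbu := (htend _ b).1 hb
    intro r hr M
    obtain ⟨t, ht, x, hx, hM⟩ :=
      hpers (fun j => Real.exp (σs (ψ j))) (fun j => Real.exp_pos _) b.1 b.2.1 hbu hbpt r hr M
    exact ⟨t, ht, x, hx, by rwa [hab t ht.2 x]⟩
  refine ⟨a.1, haW, halaw, ?_, hasing⟩
  -- ## unwinding uniform recurrence on the sup-ball of a piece containing the compact set
  intro ε hε R hR
  obtain ⟨n, hn⟩ := exists_nat_ge (R ^ 2)
  set U : Set X := {p : X | dist (Φ p n) (Φ a n) < ε} with hU
  have hUn : U ∈ 𝓝 a := by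
    have h1 : Continuous fun p : X => Φ p n := (continuous_apply n).comp hΦ.continuous
    have o1 : IsOpen U := isOpen_lt (h1.dist continuous_const) continuous_const
    refine o1.mem_nhds ?_
    show dist (Φ a n) (Φ a n) < ε
    rw [dist_self]; exact hε
  have hsyn := hrec U hUn
  rw [isSyndetic_iff_exists_window] at hsyn
  obtain ⟨L, hL, hwin⟩ := hsyn
  refine ⟨L, hL, fun a' => ?_⟩
  obtain ⟨σ, hσ, hσU⟩ := hwin a'
  refine ⟨σ, hσ, fun s hs y hy => ?_⟩
  -- the point lies in the piece `T n`
  have hR0 : 0 < R := by linarith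
  have hR1 : 1 ≤ R := hR.le
  have hRn : R ^ 2 ≤ (n : ℝ) + 2 := by linarith
  have hz : ((s, y) : ℝ × EuclideanSpace ℝ (Fin 3)) ∈ T n := by
    rw [mem_closedBall, dist_zero_right] at hy
    refine mem_slabPiece.2 ⟨⟨by linarith [hs.1], ?_⟩, ?_⟩
    · have h1 : 1 / ((n : ℝ) + 2) ≤ (R⁻¹) ^ 2 := by
        rw [inv_pow, one_div]
        exact inv_anti₀ (by positivity) hRn
      show s ≤ -(1 / ((n : ℝ) + 2))
      linarith [hs.2]
    · show ‖y‖ ≤ (n : ℝ) + 2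
      nlinarith
  have hmem : ϕ σ a ∈ U := hσU
  have hd : dist (Φ (ϕ σ a) n) (Φ a n) < ε := hmem
  have h := (ContinuousMap.dist_apply_le_dist (f := Φ (ϕ σ a) n) (g := Φ a n) ⟨(s, y), hz⟩).trans_lt hd
  rw [dist_eq_norm] at h
  have e2 : Real.exp σ ^ 2 = Real.exp (2 * σ) := by
    rw [← Real.exp_nat_mul]; norm_num
  have happ : (Φ (ϕ σ a) n) ⟨(s, y), hz⟩ = Real.exp σ • a.1 (Real.exp (2 * σ) * s) (Real.exp σ • y) := by
    show nsRescale (Real.exp σ) a.1 s y = _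
    rw [nsRescale_apply, e2]
  rw [happ] at h
  exact h.le

end Summit.NavierStokesRegularity.NavierStokesRegularity.Theorems.RecurrentReductionD

end
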